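import Summits.BirchSwinnertonDyer.Rank1Residual.F1Sign2.UnitPlaneGoverningFieldAtTwo
import HarnessLib

/-!
# DESC-45 kernel (typer -ty g22): -desc g35's glue for `F1Sign2/UnitPlaneGoverningFieldAtTwo.lean` (Sketch45 176f9c0b95284cb1) + the typer's D44.1 API + REF1-AUDIT §312 probes

CONTENT (all PROVED, no `sorry`, no `def`): `congruentIncrementPrime_of_congruent` (DESC-44-C ⟹ DESC-45-Cp; Sketch45 VERBATIM), `congruentIncrementPrime_of_governing`
(C′ ⟹ Cp; Sketch45's proof with REF1 R312a's one-token repair `hc.2.1` = `REF1_312.congruentIncrementPrime_of_governing'` of `REF1-data/b312/block312.lean` d932d5bd7e698397);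
the typer's D44.1 API (`normOneUnitNonsquareAtDegOnePrimeC_iff`, `NormOneUnitNonsquareAtDegOnePrimeC.not_dvd`, `not_integralUnitsSquareModC_of_nonsquare` — D44.1 is the
negation of DESC-35's purity `IntegralUnitsSquareModC` at one prime for norm-`+1` units) and the non-vacuity instance `normOneUnitNonsquare_cubic23_five` (`c = X³ − X − 1`,
`u = θ` of norm `+1`, `p = 5`, `a = 2`, `θ ≡ 2` a non-square mod 5; scratch `MEMO-ty-data/g22/scratch/D441Scratch.lean` 695a85c208f18032); REF1 §312 probes K312.3 (`Int.emod`
conventions) and K312.4 (the glue only uses `↔`-transitivity) as `example`s.  NOT re-homed: K312.1 `desc45M_false_as_typed` (needs the KILLED as-typed row M, which is not in the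
tree) and K312.2 `twoDivisionUCubic_W65_not_irreducible` / `no_fact_irreducible_W65` (need the auxiliary `def W65`) — both stay in REF1's evidence file.
BSD is not proved by this; 23715 is not closed by this.
-/

noncomputable section

open scoped Classical Polynomial
open Polynomial WeierstrassCurve IsDedekindDomain NumberField

namespace Summit.BirchSwinnertonDyer.Rank1Residual.F1Sign2

/-! ### -desc g35 glue (Sketch45, PROVED) -/

/-- (-desc g35 Sketch45 176f9c0b95284cb1, VERBATIM.) glue (PROVED): the tree's congruent-pair law DESC-44-C gives its prime case. -/
theorem congruentIncrementPrime_of_congruent (h : UnitPlaneCongruentIncrementLawAtTwo) : UnitPlaneCongruentIncrementLawAtTwoPrime := by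
  intro E₀ E₁ _ _ _ _ _ _ c xnum₀ xnum₁ xden₀ xden₁ B2 B4 B6 B2' B4' B6' h₀ h₁ q _ hq₀ hq₁
  exact h E₀ E₁ c xnum₀ xnum₁ xden₀ xden₁ B2 B4 B6 B2' B4' B6' h₀ h₁ q hq₀ hq₁

/-- (-desc g35 Sketch45 176f9c0b95284cb1, VERBATIM modulo REF1 R312a: `hc.2.1` supplies `c.natDegree = 3`.) glue (PROVED): ONE governing field per cubic datum ⟹ congruence-blindness of the increment at rigid primes (THM 44.1 at primes) — the quantifier order `∃ M, ∀ W` is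
the whole content used. -/
theorem congruentIncrementPrime_of_governing (h : UnitPlaneHeisenbergGoverningFieldAtTwo) : UnitPlaneCongruentIncrementLawAtTwoPrime := by
  intro E₀ E₁ _ _ _ _ _ _ c xnum₀ xnum₁ xden₀ xden₁ B2 B4 B6 B2' B4' B6' h₀ h₁ q hq hq₀ hq₁
  have hc : CubicDatumFor E₀ c xnum₀ xden₀ := h₀.1
  obtain ⟨M, hF, hN, -, -, -, -, hlaw⟩ := h c hc.1 hc.2.1 hc.2.2.1
  exact (hlaw E₀ xnum₀ xden₀ B2 B4 B6 h₀ q hq hq₀).trans (hlaw E₁ xnum₁ xden₁ B2' B4' B6' h₁ q hq hq₁).symm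

/-! ### Typer's D44.1 API (scratch `D441Scratch.lean` 695a85c208f18032, re-homed) -/

/-- Unfolding of D44.1. -/
theorem normOneUnitNonsquareAtDegOnePrimeC_iff (c : ℤ[X]) (p : ℕ) :
    NormOneUnitNonsquareAtDegOnePrimeC c p ↔
      ∃ (g : ℤ[X]) (k : ℕ) (a : ZMod p), IsIntegralUnitQuot c g k ∧ (mulMatrixCubic c g).det = (k : ℤ) ^ 3 ∧ ¬ p ∣ k ∧
        evalModC c p a = 0 ∧ ¬ IsSquare (evalModC g p a * (k : ZMod p)) :=
  Iff.rfl

/-- A witness with `p ∣ k` is excluded (the reduction `g(a)/k` would not be defined). -/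
theorem NormOneUnitNonsquareAtDegOnePrimeC.not_dvd {c : ℤ[X]} {p : ℕ} (h : NormOneUnitNonsquareAtDegOnePrimeC c p) :
    ∃ (g : ℤ[X]) (k : ℕ), IsIntegralUnitQuot c g k ∧ ¬ p ∣ k := by
  obtain ⟨g, k, _, hu, _, hk, _, _⟩ := h
  exact ⟨g, k, hu, hk⟩

/-- D44.1 contradicts DESC-35's purity at the labelled prime: if some norm-one unit is a non-square mod `𝔭_{a j}`, then `IntegralUnitsSquareModC c p a` fails. -/
theorem not_integralUnitsSquareModC_of_nonsquare {c : ℤ[X]} {p : ℕ} {a : Fin 3 → ZMod p} {j : Fin 3} {g : ℤ[X]} {k : ℕ}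
    (hu : IsIntegralUnitQuot c g k) (hk : ¬ p ∣ k) (hns : ¬ IsSquare (evalModC g p (a j) * (k : ZMod p))) :
    ¬ IntegralUnitsSquareModC c p a := fun H => hns (H g k hu hk j)

/-! ### Non-vacuity of D44.1: `c = X³ − X − 1` (disc `−23`), `u = θ` (norm `−c(0) = +1`), `p = 5`, `a = 2` (`c(2) = 5`), `θ ≡ 2` a non-square mod `5` -/

/-- `det M_X = N(θ) = +1` for `c = X³ − X − 1`. -/
theorem det_mulMatrixCubic_X_cubic23 : (mulMatrixCubic (X ^ 3 - X - 1 : ℤ[X]) X).det = 1 := by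
  simp [mulMatrixCubic, companionCubic, Matrix.det_fin_three, coeff_sub, coeff_X_pow, coeff_X, coeff_one]

/-- `θ = X/1` is an integral unit quotient of `c = X³ − X − 1`. -/
theorem isIntegralUnitQuot_X_cubic23 : IsIntegralUnitQuot (X ^ 3 - X - 1 : ℤ[X]) X 1 := by
  refine ⟨Nat.one_pos, ?_, ?_, ?_⟩
  · exact (natDegree_X_le).trans (by norm_num)
  · intro i _; simp
  · rw [det_mulMatrixCubic_X_cubic23]; simp

/-- `2` is a root of `X³ − X − 1` modulo `5`. -/
theorem evalModC_cubic23_five_two : evalModC (X ^ 3 - X - 1 : ℤ[X]) 5 2 = 0 := by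
  simp [evalModC]; decide

/-- `θ ↦ 2` under `θ ↦ a = 2`. -/
theorem evalModC_X_five_two : evalModC (X : ℤ[X]) 5 2 = 2 := by
  simp [evalModC]

/-- `2·1` is a non-square modulo `5`. -/
theorem two_mul_one_not_isSquare_zmod_five : ¬ IsSquare ((2 : ZMod 5) * ((1 : ℕ) : ZMod 5)) := by
  decide

/-- **D44.1 is inhabited**: `NormOneUnitNonsquareAtDegOnePrimeC (X³ − X − 1) 5` (witness `g = X`, `k = 1`, `a = 2`). -/
theorem normOneUnitNonsquare_cubic23_five : NormOneUnitNonsquareAtDegOnePrimeC (X ^ 3 - X - 1 : ℤ[X]) 5 :=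
  ⟨X, 1, 2, isIntegralUnitQuot_X_cubic23, by rw [det_mulMatrixCubic_X_cubic23]; norm_num, by norm_num, evalModC_cubic23_five_two,
    by rw [evalModC_X_five_two]; exact two_mul_one_not_isSquare_zmod_five⟩

/-! ### REF1-AUDIT §312 probes (`REF1-data/b312/block312.lean` d932d5bd7e698397; K312.3 / K312.4 VERBATIM as `example`s) -/
section REF1_312

/-- K312.3 (`Int.emod` conventions of DESC-45-Q and of the rows' residue clauses): negative traces / parameters land in the intended classes. -/
example : (-1 : ℤ) % 4 = 3 ∧ (-5 : ℤ) % 4 = 3 ∧ (-3 : ℤ) % 4 = 1 ∧ (7 : ℤ) % 4 = 3 ∧ (17 : ℤ) % 8 = 1 ∧ (-7 : ℤ) % 8 = 1 := by decide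

/-- K312.4: `DoorResidueDegree M q 3` is the f = 3 reading; the glue rows only use `↔`-transitivity (no arithmetic of `M`). -/
example (h : UnitPlaneHeisenbergGoverningFieldAtTwo) : UnitPlaneCongruentIncrementLawAtTwoPrime :=
  congruentIncrementPrime_of_governing h
example (h : UnitPlaneCongruentIncrementLawAtTwo) : UnitPlaneCongruentIncrementLawAtTwoPrime :=
  congruentIncrementPrime_of_congruent h

end REF1_312

end Summit.BirchSwinnertonDyer.Rank1Residual.F1Sign2

end
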